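import Summits.SmoothPoincare4.SmoothPoincare4.Theorems.SullivanDualWitnessChargeCapDefs
import Mathlib.Analysis.Complex.CauchyIntegral
import Mathlib.Analysis.Calculus.ContDiff.Operations
import Mathlib.Geometry.Manifold.ContMDiff.NormedSpace

/-!
# Stub `stub_leafFloc` of skeleton v15 (crux `WitnessCharge`, stmt-SmoothPoincare4-7824, line
`Sketch`, lead c8) — smoothness in the leaf parameter of the renormalisation constants

Registered helper `helper_leafFloc_coeff`. For the jointly smooth family of `V`-charts
`(a, w) ↦ V a w` of the leaves of the cap model (`‖a‖ < ε`), mapping the disc `‖w‖ < 1/2` into the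
cap chart domain for `a ∈ ball 0 ε₁`, with HOLOMORPHIC cap coordinates `w ↦ capCoord (V a w)` there,
and a smooth function `wz : ball 0 ε₁ → {‖w‖ < 1/4}`, the Taylor coefficients of the `t`-coordinate
`g_a w = (capCoord (V a w)).1` along the graph of `wz`,
`a ↦ g_a'(wz a)` and `a ↦ g_a''(wz a)`,
are `C^∞` on `ball 0 ε₁` (these are the affine renormalisation constants of the canonical
parametrisation of the pencil member carried by the leaf `a`).

Proof: `G (a, w) = (capCoord (V a w)).1` is real `C^∞` on `ball 0 ε₁ ×ˢ ball 0 (1/2)` (composition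
of the smooth evaluation map with the smooth cap chart); for the holomorphic slice `g_a = G (a, ·)`
the complex derivative is the real partial derivative, `g_a'(w) = ∂G (a, w) (0, 1)`
(`leafFloc_deriv_eq_fderiv_slice`), and `w ↦ g_a'(w)` is again holomorphic, so
`g_a''(w) = ∂(∂G (·) (0, 1)) (a, w) (0, 1)`; both right-hand sides are smooth functions of `(a, w)`
evaluated along the smooth graph `a ↦ (a, wz a)`.
-/

noncomputable section

set_option linter.dupNamespace false

open scoped Manifold ContDiff Topology
open Set Filter Literature.Geometry.Symplectic Literature.Topology.FourManifolds

namespace Summit.SmoothPoincare4.SmoothPoincare4.Theorems.WitnessCharge.PencilIncompleteness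

/-- **Complex derivative of a holomorphic slice = real partial derivative.** If `G : ℂ × ℂ → ℂ` is
real differentiable at `(a, w)` and the slice `w ↦ G (a, w)` is complex differentiable at `w`, then
`deriv (G (a, ·)) w = fderiv ℝ G (a, w) (0, 1)`. -/
theorem leafFloc_deriv_eq_fderiv_slice {G : ℂ × ℂ → ℂ} {a w : ℂ} (hG : DifferentiableAt ℝ G (a, w))
    (hg : DifferentiableAt ℂ (fun w' => G (a, w')) w) :
    deriv (fun w' => G (a, w')) w = fderiv ℝ G (a, w) (0, 1) := by
  have h1 : HasFDerivAt (fun w' => G (a, w')) ((fderiv ℝ G (a, w)).comp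
      (ContinuousLinearMap.inr ℝ ℂ ℂ)) w :=
    hG.hasFDerivAt.comp w (hasFDerivAt_prodMk_right a w)
  have h2 : HasFDerivAt (fun w' => G (a, w'))
      ((ContinuousLinearMap.smulRight (1 : ℂ →L[ℂ] ℂ)
        (deriv (fun w' => G (a, w')) w)).restrictScalars ℝ) w :=
    hg.hasDerivAt.hasFDerivAt.restrictScalars ℝ
  have e := congrArg (fun M : ℂ →L[ℝ] ℂ => M 1) (h1.unique h2)
  simpa using e.symm

variable {S : HomotopySphere 4} {p : S.carrier}
  {J : ∀ x : punctured p, TangentSpace (𝓡 4) x →L[ℝ] TangentSpace (𝓡 4) x} {ε' : ℝ}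

/-- **Registered helper `helper_leafFloc_coeff` — the renormalisation constants are smooth in the
leaf parameter.** See the module docstring. -/
theorem helper_leafFloc_coeff :
    ∀ (S : HomotopySphere 4) (p : S.carrier)
      (J : ∀ x : punctured p, TangentSpace (𝓡 4) x →L[ℝ] TangentSpace (𝓡 4) x) (ε' : ℝ)
      (D : CapData S p J ε') (V : ℂ → ℂ → D.X) (ε ε₁ : ℝ) (wz : ℂ → ℂ),
      ContMDiffOn 𝓘(ℝ, ℂ × ℂ) (𝓡 4) ∞ (fun q : ℂ × ℂ => V q.1 q.2) (Metric.ball 0 ε ×ˢ univ) →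
      ε₁ ≤ ε →
      ContDiffOn ℝ ∞ wz (Metric.ball 0 ε₁) →
      (∀ a ∈ Metric.ball (0 : ℂ) ε₁, ‖wz a‖ < 4⁻¹) →
      (∀ a ∈ Metric.ball (0 : ℂ) ε₁, ∀ w : ℂ, ‖w‖ < 2⁻¹ →
        V a w ∈ D.capInv '' {q : ℂ × ℂ | ‖q.1‖ < D.ρ}) →
      (∀ a ∈ Metric.ball (0 : ℂ) ε₁,
        DifferentiableOn ℂ (fun w => D.capCoord (V a w)) (Metric.ball 0 2⁻¹)) →
      ContDiffOn ℝ ∞ (fun a => deriv (fun w => (D.capCoord (V a w)).1) (wz a)) (Metric.ball 0 ε₁) ∧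
      ContDiffOn ℝ ∞ (fun a => deriv (deriv (fun w => (D.capCoord (V a w)).1)) (wz a))
        (Metric.ball 0 ε₁) := by
  intro S p J ε' D V ε ε₁ wz hEvV hε₁ε hwz hwz4 hVcap hVdiff
  -- the real `C^∞` function `G (a, w) = t(V a w)` on `O = ball 0 ε₁ ×ˢ ball 0 (1/2)`
  set G : ℂ × ℂ → ℂ := fun q => (D.capCoord (V q.1 q.2)).1 with hG
  set O : Set (ℂ × ℂ) := Metric.ball (0 : ℂ) ε₁ ×ˢ Metric.ball (0 : ℂ) 2⁻¹ with hO
  have hOo : IsOpen O := Metric.isOpen_ball.prod Metric.isOpen_ball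
  have hO2 : ∀ q ∈ O, ‖q.2‖ < 2⁻¹ := fun q hq => by
    have h := (mem_prod.1 hq).2
    rwa [Metric.mem_ball, dist_zero_right] at h
  have hGs : ContDiffOn ℝ ∞ G O := by
    have h1 : ContMDiffOn 𝓘(ℝ, ℂ × ℂ) (𝓡 4) ∞ (fun q : ℂ × ℂ => V q.1 q.2) O :=
      hEvV.mono (prod_mono (Metric.ball_subset_ball hε₁ε) (subset_univ _))
    have h2 : ContMDiffOn 𝓘(ℝ, ℂ × ℂ) 𝓘(ℝ, ℂ × ℂ) ∞ (fun q : ℂ × ℂ => D.capCoord (V q.1 q.2)) O :=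
      D.contMDiffOn_capCoord.comp h1 fun q hq => hVcap q.1 (mem_prod.1 hq).1 q.2 (hO2 q hq)
    exact h2.contDiffOn.fst
  -- the first and second partial derivatives in `w`
  set G₁ : ℂ × ℂ → ℂ := fun q => fderiv ℝ G q (0, 1) with hG₁
  have hG₁s : ContDiffOn ℝ ∞ G₁ O :=
    (hGs.fderiv_of_isOpen hOo (by simp)).clm_apply contDiffOn_const
  set G₂ : ℂ × ℂ → ℂ := fun q => fderiv ℝ G₁ q (0, 1) with hG₂
  have hG₂s : ContDiffOn ℝ ∞ G₂ O :=
    (hG₁s.fderiv_of_isOpen hOo (by simp)).clm_apply contDiffOn_const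
  -- the holomorphic slices
  have hslice : ∀ a ∈ Metric.ball (0 : ℂ) ε₁, ∀ w ∈ Metric.ball (0 : ℂ) 2⁻¹,
      deriv (fun w' => (D.capCoord (V a w')).1) w = G₁ (a, w) := by
    intro a ha w hw
    have hGd : DifferentiableAt ℝ G (a, w) :=
      (hGs.contDiffAt (hOo.mem_nhds (mk_mem_prod ha hw))).differentiableAt (by simp)
    have hgd : DifferentiableAt ℂ (fun w' => (D.capCoord (V a w')).1) w :=
      ((hVdiff a ha).fst.differentiableAt (Metric.isOpen_ball.mem_nhds hw))
    exact leafFloc_deriv_eq_fderiv_slice hGd hgd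
  have hslice₂ : ∀ a ∈ Metric.ball (0 : ℂ) ε₁, ∀ w ∈ Metric.ball (0 : ℂ) 2⁻¹,
      deriv (deriv (fun w' => (D.capCoord (V a w')).1)) w = G₂ (a, w) := by
    intro a ha w hw
    have hev : deriv (fun w' => (D.capCoord (V a w')).1) =ᶠ[𝓝 w] fun w' => G₁ (a, w') :=
      Filter.eventuallyEq_of_mem (Metric.isOpen_ball.mem_nhds hw) fun w' hw' => hslice a ha w' hw'
    rw [hev.deriv_eq]
    have hG₁d : DifferentiableAt ℝ G₁ (a, w) :=
      (hG₁s.contDiffAt (hOo.mem_nhds (mk_mem_prod ha hw))).differentiableAt (by simp)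
    -- the slice `G₁ (a, ·)` is holomorphic at `w`: it is `g_a'` near `w`
    have hana : DifferentiableAt ℂ (deriv (fun w' => (D.capCoord (V a w')).1)) w :=
      (((hVdiff a ha).fst.analyticOnNhd Metric.isOpen_ball).deriv w hw).differentiableAt
    have hg₁d : DifferentiableAt ℂ (fun w' => G₁ (a, w')) w := hana.congr_of_eventuallyEq hev.symm
    exact leafFloc_deriv_eq_fderiv_slice hG₁d hg₁d
  -- smoothness along the graph of `wz`
  have hgraph : ContDiffOn ℝ ∞ (fun a : ℂ => (a, wz a)) (Metric.ball 0 ε₁) :=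
    contDiffOn_id.prodMk hwz
  have hgraphO : ∀ a ∈ Metric.ball (0 : ℂ) ε₁, (a, wz a) ∈ O := fun a ha =>
    mk_mem_prod ha (by rw [Metric.mem_ball, dist_zero_right]; exact (hwz4 a ha).trans (by norm_num))
  refine ⟨(hG₁s.comp hgraph hgraphO).congr fun a ha => ?_,
    (hG₂s.comp hgraph hgraphO).congr fun a ha => ?_⟩
  · exact hslice a ha (wz a) (hgraphO a ha).2
  · exact hslice₂ a ha (wz a) (hgraphO a ha).2

end Summit.SmoothPoincare4.SmoothPoincare4.Theorems.WitnessCharge.PencilIncompleteness
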